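import Literature.NumberTheory.Automorphic.UnitaryGroupSingularTermLogFormUniform
import Literature.NumberTheory.Automorphic.UnitaryGroupSingularOrbitalTermCM
import Literature.NumberTheory.Automorphic.UnitaryGroupSingularClassLogFormCM
import HarnessLib

/-!
# The singular class of the CM unitary group `U(3)`, SPELLED: `J^T_{i♭}(f) = c·C·𝔄₀(f♭)·log T + (∫_X Σ'_{[γ₀]} + c·C·𝔅₀(f♭))`
(Rogawski, *Automorphic Representations of Unitary Groups in Three Variables* (1990), §7.2 Prop. 7.2.1–7.2.2, pp. 91–95.)

Topic `NumberTheory/Automorphic`; namespace `Literature.NumberTheory.Automorphic.UnitaryGroup`. THEOREMS ONLY over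
accepted tree modules: no definition, no named fact, no instance, no notation, no `sorry`. Brick (U4) = (c6-ii) of row
(L5-iii-c) of the T1-qs LAW 5 road (`Cruxes/H413/Lines/F0_T1InnerFormTraceIdentity.lean`): the per-class head of ★
`truncatedTraceClass_singular_eq_mul_log_add_cm` with (i) the analytic hypothesis `hS` DISCHARGED (★
`integrable_quotFun_tsum_conjOrbit_singular_cm`) and (ii) the coefficients SPELLED: `𝔄 = c_{μ,ν_G}·C·𝔄₀(f♭)` and
`𝔅 = ∫_X Σ'_{[γ₀]} dμ + c_{μ,ν_G}·C·𝔅₀(f♭)` with `𝔄₀, 𝔅₀` the displayed Tate data of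
`f♭(s) = ∫_{𝔸_L} ∫_K f(k⁻¹ u(x)⁻¹ γ₀ n(θ s) u(x) k)` (★ `exists_const_forall_integral_weight_smul_singularBracket_eq_mul_log_add`)
and ONE positive scalar `C` (the product of the three Haar-decomposition constants) quantified BEFORE the class — the currency
`hrow : ∀ k, q k → ∃ T₁, ∀ T > T₁, J (φ k) T = a k * log T + b k` of the (σ-ii) finset closer with `a`, `b` functions of the key.

* HEAD **`truncatedTraceClass_singular_eq_linear_cm`**.

## References
* J. D. Rogawski, *Automorphic Representations of Unitary Groups in Three Variables*, Ann. of Math. Stud. 123 (1990),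
  §7.2 Prop. 7.2.1, Prop. 7.2.2 [Rogawski1990].
* J. Arthur, *The trace formula in invariant form*, Ann. of Math. 114 (1981), §2 [Arthur1981TraceFormulaInvariantForm].
-/

set_option autoImplicit false

noncomputable section

open MeasureTheory MeasureTheory.Measure NumberField IsDedekindDomain Set Polynomial Literature.MeasureTheory.Group
open scoped NNReal ENNReal MatrixGroups Classical
open Literature.NumberTheory.Automorphic.Meyer

namespace Literature.NumberTheory.Automorphic

namespace UnitaryGroup

section CM

set_option maxHeartbeats 800000 in
/-- **`J^T_{i♭}(f) = (c·C·𝔄₀(f♭))·log T + (∫_X Σ'_{[γ₀]} dμ + c·C·𝔅₀(f♭))` FOR `T > T₀`, SPELLED, ONE `C` FOR ALL SINGULAR CLASSES**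
(CM unitary group `U(3)`, Prop. 7.2.1 + Prop. 7.2.2). Binders: the CM field `L`, `δ` with `δ̄ = -δ ≠ 0`, `δ² = θ₀ ∈ 𝓞_F ∖ 0`,
Haar measures `ν` (unipotent radical, with a fundamental domain `𝓕`), `μ` (automorphic), `ν_G, μ_B, μ_T, μ_K, μ_X, μ_A, ν_F` and an
idele class domain `𝓕_F`; THEN `∃ C > 0` such that for EVERY `a ≠ b` of norm one, base point `γ₀ = ι(d(a,b,a))` and test function
`f` there is `T₀` with the displayed identity for all `T > T₀` (`c = unfoldingConstant`, no `hS`: ★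
`integrable_quotFun_tsum_conjOrbit_singular_cm`). [cite: Rogawski1990, §7.2 Prop. 7.2.1, Prop. 7.2.2 (pp. 91–95)]
[cite: Arthur1981TraceFormulaInvariantForm, §2] -/
theorem truncatedTraceClass_singular_eq_linear_cm (L : Type) [Field L] [NumberField L]
    [IsCMField L]
    [MeasurableSpace (AdeleRing (𝓞 L) L)] [BorelSpace (AdeleRing (𝓞 L) L)]
    [MeasurableSpace (AdeleRing (𝓞 (↥(maximalRealSubfield L))) (↥(maximalRealSubfield L)))] [BorelSpace (AdeleRing (𝓞 (↥(maximalRealSubfield L))) (↥(maximalRealSubfield L)))]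
    [MeasurableSpace (adelicUnipotent (↥(maximalRealSubfield L)) L (IsCMField.complexConj L) 3)] [BorelSpace (adelicUnipotent (↥(maximalRealSubfield L)) L (IsCMField.complexConj L) 3)]
    [MeasurableSpace (quasiSplit (↥(maximalRealSubfield L)) L (IsCMField.complexConj L) 3).Adelic] [BorelSpace (quasiSplit (↥(maximalRealSubfield L)) L (IsCMField.complexConj L) 3).Adelic]
    [MeasurableSpace (GaloisRepresentations.ideleGroup (↥(maximalRealSubfield L)))] [BorelSpace (GaloisRepresentations.ideleGroup (↥(maximalRealSubfield L)))]
    (hc : (IsCMField.complexConj L) * (IsCMField.complexConj L) = 1)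
    {δ : L} (hcδ : (IsCMField.complexConj L) δ = -δ) (hδ : δ ≠ 0) (θ₀ : 𝓞 (↥(maximalRealSubfield L))) (hθ : θ₀ ≠ 0)
    (hd : δ * δ = algebraMap (↥(maximalRealSubfield L)) L (θ₀ : (↥(maximalRealSubfield L))))
    (ν : Measure (adelicUnipotent (↥(maximalRealSubfield L)) L (IsCMField.complexConj L) 3)) [ν.IsHaarMeasure]
    {𝓕 : Set (adelicUnipotent (↥(maximalRealSubfield L)) L (IsCMField.complexConj L) 3)} (h𝓕 : IsFundamentalDomain (rationalUnipotent (↥(maximalRealSubfield L)) L (IsCMField.complexConj L) 3) 𝓕 ν)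
    (μ : Measure (quasiSplit (↥(maximalRealSubfield L)) L (IsCMField.complexConj L) 3).automorphicQuotient) [(quasiSplit (↥(maximalRealSubfield L)) L (IsCMField.complexConj L) 3).IsAutomorphicMeasure μ]
    (νG : Measure (quasiSplit (↥(maximalRealSubfield L)) L (IsCMField.complexConj L) 3).Adelic) [νG.IsHaarMeasure]
    (μB : Measure (borelAdelic (↥(maximalRealSubfield L)) L (IsCMField.complexConj L) 3)) [μB.IsHaarMeasure]
    (μT : Measure (torusInBorel (↥(maximalRealSubfield L)) L (IsCMField.complexConj L) 3)) [μT.IsHaarMeasure]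
    (μK : Measure ↥((standardMaximalCompactGL 3 L).comap (adelicVal (↥(maximalRealSubfield L)) L (IsCMField.complexConj L) 3 ((StdForm.antidiagonal 3).over L)) : Subgroup (quasiSplit (↥(maximalRealSubfield L)) L (IsCMField.complexConj L) 3).Adelic)) [μK.IsHaarMeasure]
    (μX : Measure (AdeleRing (𝓞 L) L)) [μX.IsAddHaarMeasure] [μX.Regular]
    (μA : Measure (AdeleRing (𝓞 (↥(maximalRealSubfield L))) (↥(maximalRealSubfield L)))) [μA.IsAddHaarMeasure] [μA.Regular]
    (νF : Measure (GaloisRepresentations.ideleGroup (↥(maximalRealSubfield L)))) [νF.IsHaarMeasure]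
    {𝓕F : Set (GaloisRepresentations.ideleGroup (↥(maximalRealSubfield L)))} (h𝓕F : IsIdeleClassDomain (↥(maximalRealSubfield L)) 𝓕F) :
    haveI := t2Space_adeleRing_of_numberField L
    haveI := locallyCompactSpace_adeleRing' L
    haveI := secondCountableTopology_adeleRing L
    haveI : T2Space (quasiSplit (↥(maximalRealSubfield L)) L (IsCMField.complexConj L) 3).Adelic :=
      inferInstanceAs (T2Space (adelic (↥(maximalRealSubfield L)) L (IsCMField.complexConj L) 3 ((StdForm.antidiagonal 3).over L)))
    haveI : LocallyCompactSpace (quasiSplit (↥(maximalRealSubfield L)) L (IsCMField.complexConj L) 3).Adelic :=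
      inferInstanceAs (LocallyCompactSpace (adelic (↥(maximalRealSubfield L)) L (IsCMField.complexConj L) 3 ((StdForm.antidiagonal 3).over L)))
    haveI : SecondCountableTopology (quasiSplit (↥(maximalRealSubfield L)) L (IsCMField.complexConj L) 3).Adelic :=
      inferInstanceAs (SecondCountableTopology (adelic (↥(maximalRealSubfield L)) L (IsCMField.complexConj L) 3 ((StdForm.antidiagonal 3).over L)))
    haveI : DiscreteTopology (quasiSplit (↥(maximalRealSubfield L)) L (IsCMField.complexConj L) 3).quotientSubgroup := by
      rw [quotientSubgroup_quasiSplit]; exact isDiscreteRational_quasiSplit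
    letI := AdelicGroupData.measurableSpaceQuotientForm (quasiSplit (↥(maximalRealSubfield L)) L (IsCMField.complexConj L) 3)
    haveI := AdelicGroupData.borelSpaceQuotientForm (quasiSplit (↥(maximalRealSubfield L)) L (IsCMField.complexConj L) 3)
    haveI := AdelicGroupData.smulInvariantMeasureQuotientForm (quasiSplit (↥(maximalRealSubfield L)) L (IsCMField.complexConj L) 3) μ
    haveI := AdelicGroupData.isFiniteMeasureOnCompactsQuotientForm (quasiSplit (↥(maximalRealSubfield L)) L (IsCMField.complexConj L) 3) μ
    ∃ Cst : ℝ, 0 < Cst ∧ ∀ {a b : Lˣ} (hab : (a : L) ≠ (b : L)) (ha : (IsCMField.complexConj L) (a : L) * (a : L) = 1)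
      (hb : (IsCMField.complexConj L) (b : L) * (b : L) = 1) {g₀ : (quasiSplit (↥(maximalRealSubfield L)) L (IsCMField.complexConj L) 3).Rational} {γ₀ : (quasiSplit (↥(maximalRealSubfield L)) L (IsCMField.complexConj L) 3).arithmeticSubgroup}
      (hg₀ : ((g₀.val : GL (Fin 3) L) : Matrix (Fin 3) (Fin 3) L) = !![(a : L), 0, 0; 0, b, 0; 0, 0, a])
      (hγ₀ : (γ₀ : (quasiSplit (↥(maximalRealSubfield L)) L (IsCMField.complexConj L) 3).Adelic) = (quasiSplit (↥(maximalRealSubfield L)) L (IsCMField.complexConj L) 3).toAdelic g₀)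
      {f : (quasiSplit (↥(maximalRealSubfield L)) L (IsCMField.complexConj L) 3).Adelic → ℂ} (hf : IsQuasiSplitTest (↥(maximalRealSubfield L)) L (IsCMField.complexConj L) 3 f),
      ∃ T₀ : ℝ≥0, ∀ T : ℝ≥0, T₀ < T →
      truncatedTraceClass μ ν 𝓕 T (fun γ : (quasiSplit (↥(maximalRealSubfield L)) L (IsCMField.complexConj L) 3).arithmeticSubgroup => (((adelicVal (↥(maximalRealSubfield L)) L (IsCMField.complexConj L) 3 _ (γ : (quasiSplit (↥(maximalRealSubfield L)) L (IsCMField.complexConj L) 3).Adelic) :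
          GL (Fin 3) (AdeleRing (𝓞 L) L)) : Matrix (Fin 3) (Fin 3) (AdeleRing (𝓞 L) L)).charpoly,
        decide (∃ δ : (quasiSplit (↥(maximalRealSubfield L)) L (IsCMField.complexConj L) 3).arithmeticSubgroup, δ * γ * δ⁻¹ ∈ arithmeticBorel (↥(maximalRealSubfield L)) L (IsCMField.complexConj L) 3))) ((Polynomial.map (algebraMap L (AdeleRing (𝓞 L) L)) ((X - C (a : L)) ^ 2 * (X - C (b : L)))), true) f =
        (((unfoldingConstant (quasiSplit (↥(maximalRealSubfield L)) L (IsCMField.complexConj L) 3).quotientSubgroup (count : Measure (quasiSplit (↥(maximalRealSubfield L)) L (IsCMField.complexConj L) 3).quotientSubgroup) μ νG : ℝ) : ℂ) * ((Cst : ℂ) * (((((μA.map (traceZeroLine (↥(maximalRealSubfield L)) L (IsCMField.complexConj L) hcδ hδ)).real (traceZeroFundamentalDomain (↥(maximalRealSubfield L)) L (IsCMField.complexConj L)) : ℝ) : ℂ)) * ((1 / 2 : ℂ) * (((idelicCovolume (↥(maximalRealSubfield L)) νF).toReal : ℂ) * (((μA (adeleFundamentalDomain (↥(maximalRealSubfield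 L)))).toReal⁻¹ : ℂ) * adeleFourier (↥(maximalRealSubfield L)) μA (fun s : AdeleRing (𝓞 (↥(maximalRealSubfield L))) (↥(maximalRealSubfield L)) =>
      ∫ x : AdeleRing (𝓞 L) L, (∫ k : ↥((standardMaximalCompactGL 3 L).comap (adelicVal (↥(maximalRealSubfield L)) L (IsCMField.complexConj L) 3 ((StdForm.antidiagonal 3).over L)) : Subgroup (quasiSplit (↥(maximalRealSubfield L)) L (IsCMField.complexConj L) 3).Adelic), f ((k : (quasiSplit (↥(maximalRealSubfield L)) L (IsCMField.complexConj L) 3).Adelic)⁻¹ *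
        (((((heisElt hc x (0 : traceZeroAdele (↥(maximalRealSubfield L)) L (IsCMField.complexConj L)) : unipotentInBorel (↥(maximalRealSubfield L)) L (IsCMField.complexConj L) 3) : borelAdelic (↥(maximalRealSubfield L)) L (IsCMField.complexConj L) 3) : (quasiSplit (↥(maximalRealSubfield L)) L (IsCMField.complexConj L) 3).Adelic))⁻¹ *
          ((γ₀ : (quasiSplit (↥(maximalRealSubfield L)) L (IsCMField.complexConj L) 3).Adelic) * (((heisElt hc 0 (traceZeroLine (↥(maximalRealSubfield L)) L (IsCMField.complexConj L) hcδ hδ s) : unipotentInBorel (↥(maximalRealSubfield L)) L (IsCMField.complexConj L) 3) : borelAdelic (↥(maximalRealSubfield L)) L (IsCMField.complexConj L) 3) : (quasiSplit (↥(maximalRealSubfield L)) L (IsCMField.complexConj L) 3).Adelic)) *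
          (((heisElt hc x (0 : traceZeroAdele (↥(maximalRealSubfield L)) L (IsCMField.complexConj L)) : unipotentInBorel (↥(maximalRealSubfield L)) L (IsCMField.complexConj L) 3) : borelAdelic (↥(maximalRealSubfield L)) L (IsCMField.complexConj L) 3) : (quasiSplit (↥(maximalRealSubfield L)) L (IsCMField.complexConj L) 3).Adelic)) * (k : (quasiSplit (↥(maximalRealSubfield L)) L (IsCMField.complexConj L) 3).Adelic)) ∂μK) ∂μX) 0)))))) * ((Real.log (T : ℝ) : ℝ) : ℂ) +
        ((∫ x, (quasiSplit (↥(maximalRealSubfield L)) L (IsCMField.complexConj L) 3).quotFun (fun y : (quasiSplit (↥(maximalRealSubfield L)) L (IsCMField.complexConj L) 3).Adelic => ∑' s : ↥(conjOrbit (quasiSplit (↥(maximalRealSubfield L)) L (IsCMField.complexConj L) 3).arithmeticSubgroup (γ₀ : (quasiSplit (↥(maximalRealSubfield L)) L (IsCMField.complexConj L) 3).Adelic)), f (y⁻¹ * (s : (quasiSplit (↥(maximalRealSubfield L)) L (IsCMField.complexConj L) 3).Adelic) * y)) x ∂μ) +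
          ((unfoldingConstant (quasiSplit (↥(maximalRealSubfield L)) L (IsCMField.complexConj L) 3).quotientSubgroup (count : Measure (quasiSplit (↥(maximalRealSubfield L)) L (IsCMField.complexConj L) 3).quotientSubgroup) μ νG : ℝ) : ℂ) * ((Cst : ℂ) * (((((μA.map (traceZeroLine (↥(maximalRealSubfield L)) L (IsCMField.complexConj L) hcδ hδ)).real (traceZeroFundamentalDomain (↥(maximalRealSubfield L)) L (IsCMField.complexConj L)) : ℝ) : ℂ)) *
          ((1 / 2 : ℂ) * (-((((idelicCovolume (↥(maximalRealSubfield L)) νF).toReal : ℂ) * ((Real.log ((borelHeight (1 : (quasiSplit (↥(maximalRealSubfield L)) L (IsCMField.complexConj L) 3).Adelic) : ℝ≥0) : ℝ) : ℝ) : ℂ)) * (((μA (adeleFundamentalDomain (↥(maximalRealSubfield L)))).toReal⁻¹ : ℂ) * adeleFourier (↥(maximalRealSubfield L)) μA (fun s : AdeleRing (𝓞 (↥(maximalRealSubfield L))) (↥(maximalRealSubfield L)) =>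
      ∫ x : AdeleRing (𝓞 L) L, (∫ k : ↥((standardMaximalCompactGL 3 L).comap (adelicVal (↥(maximalRealSubfield L)) L (IsCMField.complexConj L) 3 ((StdForm.antidiagonal 3).over L)) : Subgroup (quasiSplit (↥(maximalRealSubfield L)) L (IsCMField.complexConj L) 3).Adelic), f ((k : (quasiSplit (↥(maximalRealSubfield L)) L (IsCMField.complexConj L) 3).Adelic)⁻¹ *
        (((((heisElt hc x (0 : traceZeroAdele (↥(maximalRealSubfield L)) L (IsCMField.complexConj L)) : unipotentInBorel (↥(maximalRealSubfield L)) L (IsCMField.complexConj L) 3) : borelAdelic (↥(maximalRealSubfield L)) L (IsCMField.complexConj L) 3) : (quasiSplit (↥(maximalRealSubfield L)) L (IsCMField.complexConj L) 3).Adelic))⁻¹ *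
          ((γ₀ : (quasiSplit (↥(maximalRealSubfield L)) L (IsCMField.complexConj L) 3).Adelic) * (((heisElt hc 0 (traceZeroLine (↥(maximalRealSubfield L)) L (IsCMField.complexConj L) hcδ hδ s) : unipotentInBorel (↥(maximalRealSubfield L)) L (IsCMField.complexConj L) 3) : borelAdelic (↥(maximalRealSubfield L)) L (IsCMField.complexConj L) 3) : (quasiSplit (↥(maximalRealSubfield L)) L (IsCMField.complexConj L) 3).Adelic)) *
          (((heisElt hc x (0 : traceZeroAdele (↥(maximalRealSubfield L)) L (IsCMField.complexConj L)) : unipotentInBorel (↥(maximalRealSubfield L)) L (IsCMField.complexConj L) 3) : borelAdelic (↥(maximalRealSubfield L)) L (IsCMField.complexConj L) 3) : (quasiSplit (↥(maximalRealSubfield L)) L (IsCMField.complexConj L) 3).Adelic)) * (k : (quasiSplit (↥(maximalRealSubfield L)) L (IsCMField.complexConj L) 3).Adelic)) ∂μK) ∂μX) 0)) +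
              ((∫ x in {x | 1 ≤ (IdeleClassGroup.ideleNorm (↥(maximalRealSubfield L)) x : ℝ)} ∩ 𝓕F,
                  ideleSum (↥(maximalRealSubfield L)) (fun s : AdeleRing (𝓞 (↥(maximalRealSubfield L))) (↥(maximalRealSubfield L)) =>
      ∫ x : AdeleRing (𝓞 L) L, (∫ k : ↥((standardMaximalCompactGL 3 L).comap (adelicVal (↥(maximalRealSubfield L)) L (IsCMField.complexConj L) 3 ((StdForm.antidiagonal 3).over L)) : Subgroup (quasiSplit (↥(maximalRealSubfield L)) L (IsCMField.complexConj L) 3).Adelic), f ((k : (quasiSplit (↥(maximalRealSubfield L)) L (IsCMField.complexConj L) 3).Adelic)⁻¹ *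
        (((((heisElt hc x (0 : traceZeroAdele (↥(maximalRealSubfield L)) L (IsCMField.complexConj L)) : unipotentInBorel (↥(maximalRealSubfield L)) L (IsCMField.complexConj L) 3) : borelAdelic (↥(maximalRealSubfield L)) L (IsCMField.complexConj L) 3) : (quasiSplit (↥(maximalRealSubfield L)) L (IsCMField.complexConj L) 3).Adelic))⁻¹ *
          ((γ₀ : (quasiSplit (↥(maximalRealSubfield L)) L (IsCMField.complexConj L) 3).Adelic) * (((heisElt hc 0 (traceZeroLine (↥(maximalRealSubfield L)) L (IsCMField.complexConj L) hcδ hδ s) : unipotentInBorel (↥(maximalRealSubfield L)) L (IsCMField.complexConj L) 3) : borelAdelic (↥(maximalRealSubfield L)) L (IsCMField.complexConj L) 3) : (quasiSplit (↥(maximalRealSubfield L)) L (IsCMField.complexConj L) 3).Adelic)) *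
          (((heisElt hc x (0 : traceZeroAdele (↥(maximalRealSubfield L)) L (IsCMField.complexConj L)) : unipotentInBorel (↥(maximalRealSubfield L)) L (IsCMField.complexConj L) 3) : borelAdelic (↥(maximalRealSubfield L)) L (IsCMField.complexConj L) 3) : (quasiSplit (↥(maximalRealSubfield L)) L (IsCMField.complexConj L) 3).Adelic)) * (k : (quasiSplit (↥(maximalRealSubfield L)) L (IsCMField.complexConj L) 3).Adelic)) ∂μK) ∂μX) x * ((IdeleClassGroup.ideleNorm (↥(maximalRealSubfield L)) x : ℝ) : ℂ) ∂νF) +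
                ((μA (adeleFundamentalDomain (↥(maximalRealSubfield L)))).toReal⁻¹ : ℂ) *
                  (∫ x in {x | 1 ≤ (IdeleClassGroup.ideleNorm (↥(maximalRealSubfield L)) x : ℝ)} ∩ 𝓕F,
                    ideleSum (↥(maximalRealSubfield L)) (adeleFourier (↥(maximalRealSubfield L)) μA (fun s : AdeleRing (𝓞 (↥(maximalRealSubfield L))) (↥(maximalRealSubfield L)) =>
      ∫ x : AdeleRing (𝓞 L) L, (∫ k : ↥((standardMaximalCompactGL 3 L).comap (adelicVal (↥(maximalRealSubfield L)) L (IsCMField.complexConj L) 3 ((StdForm.antidiagonal 3).over L)) : Subgroup (quasiSplit (↥(maximalRealSubfield L)) L (IsCMField.complexConj L) 3).Adelic), f ((k : (quasiSplit (↥(maximalRealSubfield L)) L (IsCMField.complexConj L) 3).Adelic)⁻¹ *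
        (((((heisElt hc x (0 : traceZeroAdele (↥(maximalRealSubfield L)) L (IsCMField.complexConj L)) : unipotentInBorel (↥(maximalRealSubfield L)) L (IsCMField.complexConj L) 3) : borelAdelic (↥(maximalRealSubfield L)) L (IsCMField.complexConj L) 3) : (quasiSplit (↥(maximalRealSubfield L)) L (IsCMField.complexConj L) 3).Adelic))⁻¹ *
          ((γ₀ : (quasiSplit (↥(maximalRealSubfield L)) L (IsCMField.complexConj L) 3).Adelic) * (((heisElt hc 0 (traceZeroLine (↥(maximalRealSubfield L)) L (IsCMField.complexConj L) hcδ hδ s) : unipotentInBorel (↥(maximalRealSubfield L)) L (IsCMField.complexConj L) 3) : borelAdelic (↥(maximalRealSubfield L)) L (IsCMField.complexConj L) 3) : (quasiSplit (↥(maximalRealSubfield L)) L (IsCMField.complexConj L) 3).Adelic)) *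
          (((heisElt hc x (0 : traceZeroAdele (↥(maximalRealSubfield L)) L (IsCMField.complexConj L)) : unipotentInBorel (↥(maximalRealSubfield L)) L (IsCMField.complexConj L) 3) : borelAdelic (↥(maximalRealSubfield L)) L (IsCMField.complexConj L) 3) : (quasiSplit (↥(maximalRealSubfield L)) L (IsCMField.complexConj L) 3).Adelic)) * (k : (quasiSplit (↥(maximalRealSubfield L)) L (IsCMField.complexConj L) 3).Adelic)) ∂μK) ∂μX)) x ∂νF) -
                ((idelicCovolume (↥(maximalRealSubfield L)) νF).toReal : ℂ) * (fun s : AdeleRing (𝓞 (↥(maximalRealSubfield L))) (↥(maximalRealSubfield L)) =>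
      ∫ x : AdeleRing (𝓞 L) L, (∫ k : ↥((standardMaximalCompactGL 3 L).comap (adelicVal (↥(maximalRealSubfield L)) L (IsCMField.complexConj L) 3 ((StdForm.antidiagonal 3).over L)) : Subgroup (quasiSplit (↥(maximalRealSubfield L)) L (IsCMField.complexConj L) 3).Adelic), f ((k : (quasiSplit (↥(maximalRealSubfield L)) L (IsCMField.complexConj L) 3).Adelic)⁻¹ *
        (((((heisElt hc x (0 : traceZeroAdele (↥(maximalRealSubfield L)) L (IsCMField.complexConj L)) : unipotentInBorel (↥(maximalRealSubfield L)) L (IsCMField.complexConj L) 3) : borelAdelic (↥(maximalRealSubfield L)) L (IsCMField.complexConj L) 3) : (quasiSplit (↥(maximalRealSubfield L)) L (IsCMField.complexConj L) 3).Adelic))⁻¹ *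
          ((γ₀ : (quasiSplit (↥(maximalRealSubfield L)) L (IsCMField.complexConj L) 3).Adelic) * (((heisElt hc 0 (traceZeroLine (↥(maximalRealSubfield L)) L (IsCMField.complexConj L) hcδ hδ s) : unipotentInBorel (↥(maximalRealSubfield L)) L (IsCMField.complexConj L) 3) : borelAdelic (↥(maximalRealSubfield L)) L (IsCMField.complexConj L) 3) : (quasiSplit (↥(maximalRealSubfield L)) L (IsCMField.complexConj L) 3).Adelic)) *
          (((heisElt hc x (0 : traceZeroAdele (↥(maximalRealSubfield L)) L (IsCMField.complexConj L)) : unipotentInBorel (↥(maximalRealSubfield L)) L (IsCMField.complexConj L) 3) : borelAdelic (↥(maximalRealSubfield L)) L (IsCMField.complexConj L) 3) : (quasiSplit (↥(maximalRealSubfield L)) L (IsCMField.complexConj L) 3).Adelic)) * (k : (quasiSplit (↥(maximalRealSubfield L)) L (IsCMField.complexConj L) 3).Adelic)) ∂μK) ∂μX) 0)) +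
            (1 / 2 : ℂ) * ((∫ x in {x | 1 ≤ (IdeleClassGroup.ideleNorm (↥(maximalRealSubfield L)) x : ℝ)} ∩ 𝓕F,
                ideleSum (↥(maximalRealSubfield L)) (fun s : AdeleRing (𝓞 (↥(maximalRealSubfield L))) (↥(maximalRealSubfield L)) =>
      ∫ x : AdeleRing (𝓞 L) L, (∫ k : ↥((standardMaximalCompactGL 3 L).comap (adelicVal (↥(maximalRealSubfield L)) L (IsCMField.complexConj L) 3 ((StdForm.antidiagonal 3).over L)) : Subgroup (quasiSplit (↥(maximalRealSubfield L)) L (IsCMField.complexConj L) 3).Adelic), f ((k : (quasiSplit (↥(maximalRealSubfield L)) L (IsCMField.complexConj L) 3).Adelic)⁻¹ *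
        (((((heisElt hc x (0 : traceZeroAdele (↥(maximalRealSubfield L)) L (IsCMField.complexConj L)) : unipotentInBorel (↥(maximalRealSubfield L)) L (IsCMField.complexConj L) 3) : borelAdelic (↥(maximalRealSubfield L)) L (IsCMField.complexConj L) 3) : (quasiSplit (↥(maximalRealSubfield L)) L (IsCMField.complexConj L) 3).Adelic))⁻¹ *
          ((γ₀ : (quasiSplit (↥(maximalRealSubfield L)) L (IsCMField.complexConj L) 3).Adelic) * (((heisElt hc 0 (traceZeroLine (↥(maximalRealSubfield L)) L (IsCMField.complexConj L) hcδ hδ s) : unipotentInBorel (↥(maximalRealSubfield L)) L (IsCMField.complexConj L) 3) : borelAdelic (↥(maximalRealSubfield L)) L (IsCMField.complexConj L) 3) : (quasiSplit (↥(maximalRealSubfield L)) L (IsCMField.complexConj L) 3).Adelic)) *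
          (((heisElt hc x (0 : traceZeroAdele (↥(maximalRealSubfield L)) L (IsCMField.complexConj L)) : unipotentInBorel (↥(maximalRealSubfield L)) L (IsCMField.complexConj L) 3) : borelAdelic (↥(maximalRealSubfield L)) L (IsCMField.complexConj L) 3) : (quasiSplit (↥(maximalRealSubfield L)) L (IsCMField.complexConj L) 3).Adelic)) * (k : (quasiSplit (↥(maximalRealSubfield L)) L (IsCMField.complexConj L) 3).Adelic)) ∂μK) ∂μX) x * (-1 : ℂ) ^ (GaloisRepresentations.quadraticArtinIndicator (↥(maximalRealSubfield L)) ((θ₀ : 𝓞 (↥(maximalRealSubfield L))) : (↥(maximalRealSubfield L))) x).val *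
                  ((IdeleClassGroup.ideleNorm (↥(maximalRealSubfield L)) x : ℝ) : ℂ) ∂νF) +
              ((μA (adeleFundamentalDomain (↥(maximalRealSubfield L)))).toReal⁻¹ : ℂ) *
                ∫ x in {x | 1 ≤ (IdeleClassGroup.ideleNorm (↥(maximalRealSubfield L)) x : ℝ)} ∩ 𝓕F,
                  ideleSum (↥(maximalRealSubfield L)) (adeleFourier (↥(maximalRealSubfield L)) μA (fun s : AdeleRing (𝓞 (↥(maximalRealSubfield L))) (↥(maximalRealSubfield L)) =>
      ∫ x : AdeleRing (𝓞 L) L, (∫ k : ↥((standardMaximalCompactGL 3 L).comap (adelicVal (↥(maximalRealSubfield L)) L (IsCMField.complexConj L) 3 ((StdForm.antidiagonal 3).over L)) : Subgroup (quasiSplit (↥(maximalRealSubfield L)) L (IsCMField.complexConj L) 3).Adelic), f ((k : (quasiSplit (↥(maximalRealSubfield L)) L (IsCMField.complexConj L) 3).Adelic)⁻¹ *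
        (((((heisElt hc x (0 : traceZeroAdele (↥(maximalRealSubfield L)) L (IsCMField.complexConj L)) : unipotentInBorel (↥(maximalRealSubfield L)) L (IsCMField.complexConj L) 3) : borelAdelic (↥(maximalRealSubfield L)) L (IsCMField.complexConj L) 3) : (quasiSplit (↥(maximalRealSubfield L)) L (IsCMField.complexConj L) 3).Adelic))⁻¹ *
          ((γ₀ : (quasiSplit (↥(maximalRealSubfield L)) L (IsCMField.complexConj L) 3).Adelic) * (((heisElt hc 0 (traceZeroLine (↥(maximalRealSubfield L)) L (IsCMField.complexConj L) hcδ hδ s) : unipotentInBorel (↥(maximalRealSubfield L)) L (IsCMField.complexConj L) 3) : borelAdelic (↥(maximalRealSubfield L)) L (IsCMField.complexConj L) 3) : (quasiSplit (↥(maximalRealSubfield L)) L (IsCMField.complexConj L) 3).Adelic)) *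
          (((heisElt hc x (0 : traceZeroAdele (↥(maximalRealSubfield L)) L (IsCMField.complexConj L)) : unipotentInBorel (↥(maximalRealSubfield L)) L (IsCMField.complexConj L) 3) : borelAdelic (↥(maximalRealSubfield L)) L (IsCMField.complexConj L) 3) : (quasiSplit (↥(maximalRealSubfield L)) L (IsCMField.complexConj L) 3).Adelic)) * (k : (quasiSplit (↥(maximalRealSubfield L)) L (IsCMField.complexConj L) 3).Adelic)) ∂μK) ∂μX)) x *
                    (-1 : ℂ) ^ (GaloisRepresentations.quadraticArtinIndicator (↥(maximalRealSubfield L)) ((θ₀ : 𝓞 (↥(maximalRealSubfield L))) : (↥(maximalRealSubfield L))) x⁻¹).val ∂νF))))) := by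
  classical
  haveI := t2Space_adeleRing_of_numberField L
  haveI := locallyCompactSpace_adeleRing' L
  haveI := secondCountableTopology_adeleRing L
  haveI : T2Space (quasiSplit (↥(maximalRealSubfield L)) L (IsCMField.complexConj L) 3).Adelic :=
    inferInstanceAs (T2Space (adelic (↥(maximalRealSubfield L)) L (IsCMField.complexConj L) 3 ((StdForm.antidiagonal 3).over L)))
  haveI : LocallyCompactSpace (quasiSplit (↥(maximalRealSubfield L)) L (IsCMField.complexConj L) 3).Adelic :=
    inferInstanceAs (LocallyCompactSpace (adelic (↥(maximalRealSubfield L)) L (IsCMField.complexConj L) 3 ((StdForm.antidiagonal 3).over L)))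
  haveI : SecondCountableTopology (quasiSplit (↥(maximalRealSubfield L)) L (IsCMField.complexConj L) 3).Adelic :=
    inferInstanceAs (SecondCountableTopology (adelic (↥(maximalRealSubfield L)) L (IsCMField.complexConj L) 3 ((StdForm.antidiagonal 3).over L)))
  haveI : DiscreteTopology (quasiSplit (↥(maximalRealSubfield L)) L (IsCMField.complexConj L) 3).quotientSubgroup := by
    rw [quotientSubgroup_quasiSplit]; exact isDiscreteRational_quasiSplit
  letI := AdelicGroupData.measurableSpaceQuotientForm (quasiSplit (↥(maximalRealSubfield L)) L (IsCMField.complexConj L) 3)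
  haveI := AdelicGroupData.borelSpaceQuotientForm (quasiSplit (↥(maximalRealSubfield L)) L (IsCMField.complexConj L) 3)
  haveI := AdelicGroupData.smulInvariantMeasureQuotientForm (quasiSplit (↥(maximalRealSubfield L)) L (IsCMField.complexConj L) 3) μ
  haveI := AdelicGroupData.isFiniteMeasureOnCompactsQuotientForm (quasiSplit (↥(maximalRealSubfield L)) L (IsCMField.complexConj L) 3) μ
  haveI := locallyCompactSpace_adeleRing' (↥(maximalRealSubfield L))
  -- structure on `B(𝔸)`, `T(𝔸)`, `K_U`, `𝔸_E⁻`
  haveI : BorelSpace (borelAdelic (↥(maximalRealSubfield L)) L (IsCMField.complexConj L) 3) := Subtype.borelSpace _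
  haveI : LocallyCompactSpace (borelAdelic (↥(maximalRealSubfield L)) L (IsCMField.complexConj L) 3) := locallyCompactSpace_borelAdelic
  haveI : SecondCountableTopology (borelAdelic (↥(maximalRealSubfield L)) L (IsCMField.complexConj L) 3) := secondCountableTopology_borelAdelic
  haveI : T2Space (borelAdelic (↥(maximalRealSubfield L)) L (IsCMField.complexConj L) 3) := t2Space_borelAdelic
  haveI : BorelSpace (torusInBorel (↥(maximalRealSubfield L)) L (IsCMField.complexConj L) 3) := Subtype.borelSpace _
  haveI : SecondCountableTopology (torusInBorel (↥(maximalRealSubfield L)) L (IsCMField.complexConj L) 3) := TopologicalSpace.Subtype.secondCountableTopology _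
  haveI := locallyCompactSpace_traceZeroAdele (F := (↥(maximalRealSubfield L))) (E := L) (c := (IsCMField.complexConj L))
  haveI : SecondCountableTopology (traceZeroAdele (↥(maximalRealSubfield L)) L (IsCMField.complexConj L)) := TopologicalSpace.Subtype.secondCountableTopology _
  haveI : BorelSpace (traceZeroAdele (↥(maximalRealSubfield L)) L (IsCMField.complexConj L)) := Subtype.borelSpace _
  haveI := discreteTopology_subgroupOf_torusInBorel (F := (↥(maximalRealSubfield L))) (E := L) (c := (IsCMField.complexConj L)) (N := 3)
  -- CM facts
  have hc1 : (IsCMField.complexConj L) ≠ 1 := IsCMField.complexConj_ne_one L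
  have hBK := exists_mem_borelAdelic_mul_mem_standardMaximalCompactGL_cm_three L
  have hsq : ¬ IsSquare ((θ₀ : 𝓞 (↥(maximalRealSubfield L))) : (↥(maximalRealSubfield L))) := not_isSquare_of_conj_eq_neg hcδ hδ hd
  -- the centre measure `μ_Y := θ_* μ_A`
  haveI hμY : (μA.map (traceZeroLine (↥(maximalRealSubfield L)) L (IsCMField.complexConj L) hcδ hδ)).IsAddHaarMeasure :=
    (traceZeroLine (↥(maximalRealSubfield L)) L (IsCMField.complexConj L) hcδ hδ).isAddHaarMeasure_map μA
  haveI : (μA.map (traceZeroLine (↥(maximalRealSubfield L)) L (IsCMField.complexConj L) hcδ hδ)).Regular := Regular.map (traceZeroLine (↥(maximalRealSubfield L)) L (IsCMField.complexConj L) hcδ hδ).toHomeomorph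
  -- the uniform `G(𝔸)`-side value
  obtain ⟨Cst, hC, hU⟩ := exists_const_forall_integral_weight_smul_singularBracket_eq_mul_log_add (F := (↥(maximalRealSubfield L))) (E := L) (c := (IsCMField.complexConj L))
    hc hc1 hcδ hδ θ₀ hθ hd hsq hBK νG μB μT μK μX μA νF
  refine ⟨Cst, hC, ?_⟩
  intro a b hab ha hb g₀ γ₀ hg₀ hγ₀ f hf
  -- the covering weights
  haveI : DiscreteTopology ↥((arithmeticBorel (↥(maximalRealSubfield L)) L (IsCMField.complexConj L) 3 ⊓ Subgroup.centralizer ({γ₀} : Set (quasiSplit (↥(maximalRealSubfield L)) L (IsCMField.complexConj L) 3).arithmeticSubgroup)).map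
      (quasiSplit (↥(maximalRealSubfield L)) L (IsCMField.complexConj L) 3).arithmeticSubgroup.subtype) :=
    DiscreteTopology.of_subset (isDiscreteRational_quasiSplit : DiscreteTopology (quasiSplit (↥(maximalRealSubfield L)) L (IsCMField.complexConj L) 3).arithmeticSubgroup)
      (show ((((arithmeticBorel (↥(maximalRealSubfield L)) L (IsCMField.complexConj L) 3 ⊓ Subgroup.centralizer ({γ₀} : Set (quasiSplit (↥(maximalRealSubfield L)) L (IsCMField.complexConj L) 3).arithmeticSubgroup)).map
        (quasiSplit (↥(maximalRealSubfield L)) L (IsCMField.complexConj L) 3).arithmeticSubgroup.subtype : Subgroup (quasiSplit (↥(maximalRealSubfield L)) L (IsCMField.complexConj L) 3).Adelic) : Set (quasiSplit (↥(maximalRealSubfield L)) L (IsCMField.complexConj L) 3).Adelic) ⊆ ((quasiSplit (↥(maximalRealSubfield L)) L (IsCMField.complexConj L) 3).arithmeticSubgroup : Set (quasiSplit (↥(maximalRealSubfield L)) L (IsCMField.complexConj L) 3).Adelic)) from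
        fun x hx => Subgroup.map_subtype_le _ hx)
  obtain ⟨β, hβ⟩ := exists_isCoveringWeight ((arithmeticBorel (↥(maximalRealSubfield L)) L (IsCMField.complexConj L) 3 ⊓
    Subgroup.centralizer ({γ₀} : Set (quasiSplit (↥(maximalRealSubfield L)) L (IsCMField.complexConj L) 3).arithmeticSubgroup)).map (quasiSplit (↥(maximalRealSubfield L)) L (IsCMField.complexConj L) 3).arithmeticSubgroup.subtype)
  obtain ⟨wT, hwT⟩ := exists_isCoveringWeight_torusInBorel (F := (↥(maximalRealSubfield L))) (E := L) (c := (IsCMField.complexConj L)) (N := 3)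
  -- `hS` discharged, the `X`-side unfolding
  have hS := integrable_quotFun_tsum_conjOrbit_singular_cm L hg₀ hγ₀ hab μ hf
  obtain ⟨T₀, hX⟩ := truncatedTraceClass_singular_eq_integral_add_mul_integral_singularBracket_cm L hc hg₀ hγ₀ hab ha hb ν h𝓕 μ
    νG (μA.map (traceZeroLine (↥(maximalRealSubfield L)) L (IsCMField.complexConj L) hcδ hδ)) hf hβ hS
  refine ⟨T₀, fun T hT => ?_⟩
  have hT0 : 0 < (T : ℝ) := lt_of_le_of_lt T₀.2 (by exact_mod_cast hT)
  rw [hX T hT, hU hab hg₀ hγ₀ hf hβ hwT h𝓕F T hT0]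
  ring

end CM

end UnitaryGroup

end Literature.NumberTheory.Automorphic
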